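import Literature.AlgebraicGeometry.ComplexMultiplication.PrincipalModelOfCMOrder
import Literature.AlgebraicGeometry.Motives.BaseChangeAlongInverse
import Mathlib.NumberTheory.NumberField.Basic
import HarnessLib

/-!
# André ↦ Riemann, part 1: rational actions on `End⁰`

HONEST FRAMING: elementary ring-homomorphism constructions on the endomorphism algebra
`End⁰(A) = ℚ ⊗_ℤ End A` of an abelian variety (`Motives.AbelianVariety.endAlgebra`), used by the
INFLATION step of the derivation `DeligneMilne1982_Thm_6_20_full → Andre1992_…_weilClasses`
(Shimura 1998 §6.2, «`A ⊗_K M`»: a CM abelian variety of type `(K; Φ)` gives, on a power `Aᵐ`,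
an action of any degree-`m` extension `M ⊇ K` through the regular representation
`M ↪ Mat_m(K) ↪ End⁰(Aᵐ)`). Nothing here is specific to CM theory or to `ℂ`:

* `ratAction ι : K →+* End⁰(A)` — the `ℚ`-linear extension of an integral action
  `ι : 𝓞_K → End A` of the maximal order of a number field `K` (`𝓞_K ⊗ ℚ = K`), and
  `ratAction_algebraMap : ratAction ι a = 1 ⊗ ι a`;
* `diagEnd B m : End B →+* End (Bᵐ)` — the diagonal action on the biproduct `Bᵐ = ⨁_{Fin m} B`;
* `blockAct φ : Matrix (Fin m) (Fin m) R →+* End⁰(Bᵐ)` — block matrices: for a ring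
  homomorphism `φ : R → End⁰(B)`, the matrix `M` acts by `Σ_{j,k} φ(M_{jk}) · e_{jk}` with the
  matrix units `e_{jk} = π_k ≫ ι_j` of the biproduct (Mumford §19: `End⁰(Bᵐ) = Mat_m(End⁰ B)`).

## References
* [Shimura1998] G. Shimura, *Abelian Varieties with Complex Multiplication and Modular Functions*,
  Princeton 1998, §6.2 (type inflation), §7.1 (orders and `End⁰`).
* [MumfordAV1970] D. Mumford, *Abelian Varieties*, §19 (`End⁰(X)`, products).

Provenance: Literature home (namespace `Literature.AlgebraicGeometry.ComplexMultiplication.AndreRiemann`) of the Summits-side `HodgeConjecture/CorCM/AndreRiemannRationalAction` (imports `Literature/` and Mathlib only), re-homed so that the Literature named facts it proves are discharged Literature-side under their exact names. Lane `lit-hodgefound`, seat p20.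
-/

noncomputable section

open _root_.CategoryTheory _root_.CategoryTheory.Limits NumberField
open scoped TensorProduct

namespace Literature.AlgebraicGeometry.ComplexMultiplication.AndreRiemann

open Literature.AlgebraicGeometry.Motives Literature.AlgebraicGeometry.Motives.AbelianVariety

universe u

variable {k : Type u} [Field k]

attribute [local instance] endAlgebra.isScalarTower_int_rat

/-! ## §1 The rational extension `K → End⁰(A)` of an integral action `𝓞_K → End A` -/

section RatAction

variable {K : Type} [Field K] [NumberField K] {A : AbelianVariety k}

/-- The `ℚ`-linear map `K → End⁰(A)` sending the integral basis vector `bᵢ ∈ 𝓞_K` to `1 ⊗ ι(bᵢ)`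
(`K = ℚ ⊗ 𝓞_K`, Mathlib `NumberField.integralBasis`). [cite: Shimura1998, §7.1 (pp. 46–47)] -/
def ratActionLin (ι : 𝓞 K →+* End A) : K →ₗ[ℚ] A.endAlgebra :=
  (integralBasis K).constr ℚ fun i => endAlgebra.of A (ι (RingOfIntegers.basis K i))

/-- On `𝓞_K` the linear extension is `a ↦ 1 ⊗ ι(a)` (two `ℤ`-linear maps agreeing on the
integral basis). [cite: Shimura1998, §7.1 (pp. 46–47)] -/
theorem ratActionLin_algebraMap (ι : 𝓞 K →+* End A) (a : 𝓞 K) :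
    ratActionLin ι (algebraMap (𝓞 K) K a) = endAlgebra.of A (ι a) := by
  have h : (ratActionLin ι).restrictScalars ℤ ∘ₗ (Algebra.linearMap (𝓞 K) K).restrictScalars ℤ =
      ((endAlgebra.of A).comp ι).toAddMonoidHom.toIntLinearMap := by
    refine (RingOfIntegers.basis K).ext fun i => ?_
    change ratActionLin ι (algebraMap (𝓞 K) K (RingOfIntegers.basis K i)) =
      endAlgebra.of A (ι (RingOfIntegers.basis K i))
    rw [← integralBasis_apply, ratActionLin, Module.Basis.constr_basis]
  exact LinearMap.congr_fun h a

/-- The linear extension is multiplicative (both sides are `ℚ`-bilinear and agree on pairs of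
integral basis vectors, where it is the ring homomorphism `1 ⊗ ι`). [cite: Shimura1998, §7.1 (pp. 46–47)] -/
theorem ratActionLin_mul (ι : 𝓞 K →+* End A) (x y : K) :
    ratActionLin ι (x * y) = ratActionLin ι x * ratActionLin ι y := by
  let B₁ : K →ₗ[ℚ] K →ₗ[ℚ] A.endAlgebra :=
    LinearMap.mk₂ ℚ (fun x y => ratActionLin ι (x * y)) (fun x y z => by rw [add_mul, map_add])
      (fun c x y => by rw [smul_mul_assoc, map_smul]) (fun x y z => by rw [mul_add, map_add])
      (fun c x y => by rw [mul_smul_comm, map_smul])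
  let B₂ : K →ₗ[ℚ] K →ₗ[ℚ] A.endAlgebra :=
    LinearMap.mk₂ ℚ (fun x y => ratActionLin ι x * ratActionLin ι y)
      (fun x y z => by rw [map_add, add_mul]) (fun c x y => by rw [map_smul, smul_mul_assoc])
      (fun x y z => by rw [map_add, mul_add]) (fun c x y => by rw [map_smul, mul_smul_comm])
  have h : B₁ = B₂ := by
    refine (integralBasis K).ext fun i => (integralBasis K).ext fun j => ?_
    simp only [B₁, B₂, LinearMap.mk₂_apply]
    rw [integralBasis_apply, integralBasis_apply, ← map_mul, ratActionLin_algebraMap,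
      ratActionLin_algebraMap, ratActionLin_algebraMap, map_mul, map_mul]
  have h' := LinearMap.congr_fun (LinearMap.congr_fun h x) y
  simpa only [B₁, B₂, LinearMap.mk₂_apply] using h'

/-- **The rational action `K → End⁰(A)` extending `ι : 𝓞_K → End A`** (`𝔯 ⊗ ℚ`, Shimura §7.1:
«`ι` an isomorphism of `F` into `End_Q(A)`» recovered from the order). [cite: Shimura1998, §7.1 (pp. 46–47)] -/
def ratAction (ι : 𝓞 K →+* End A) : K →+* A.endAlgebra where
  toFun := ratActionLin ι
  map_one' := by rw [← map_one (algebraMap (𝓞 K) K), ratActionLin_algebraMap, map_one, map_one]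
  map_mul' := ratActionLin_mul ι
  map_zero' := map_zero _
  map_add' := map_add _

/-- `ratAction ι` extends `1 ⊗ ι`. [cite: Shimura1998, §7.1 (pp. 46–47)] -/
theorem ratAction_algebraMap (ι : 𝓞 K →+* End A) (a : 𝓞 K) :
    ratAction ι (algebraMap (𝓞 K) K a) = endAlgebra.of A (ι a) :=
  ratActionLin_algebraMap ι a

end RatAction

/-! ## §2 Diagonal endomorphisms and matrix units of a power `Bᵐ = ⨁_{Fin m} B` -/

section Blocks

variable (B : AbelianVariety k) (m : ℕ)

/-- `biproduct.map` of a constant family is additive. [cite: Shimura1998, §7.1 (pp. 46–47), auxiliary step] -/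
theorem biproduct_map_const_add (f g : B ⟶ B) :
    (biproduct.map fun _ : Fin m => f + g) =
      (biproduct.map fun _ : Fin m => f) + biproduct.map fun _ : Fin m => g :=
  biproduct.hom_ext _ _ fun j => by
    rw [biproduct.map_π, Preadditive.add_comp, biproduct.map_π, biproduct.map_π, Preadditive.comp_add]

/-- `biproduct.map` of the constant zero family is zero. [cite: Shimura1998, §7.1 (pp. 46–47), auxiliary step] -/
theorem biproduct_map_const_zero :
    (biproduct.map fun _ : Fin m => (0 : B ⟶ B)) = 0 :=
  biproduct.hom_ext _ _ fun j => by rw [biproduct.map_π, comp_zero, zero_comp]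

/-- `biproduct.map` of constant families is compatible with composition. [cite: Shimura1998, §7.1 (pp. 46–47), auxiliary step] -/
theorem biproduct_map_const_comp (f g : B ⟶ B) :
    (biproduct.map fun _ : Fin m => f ≫ g) =
      (biproduct.map fun _ : Fin m => f) ≫ biproduct.map fun _ : Fin m => g :=
  biproduct.hom_ext _ _ fun j => by
    rw [biproduct.map_π, Category.assoc, biproduct.map_π, biproduct.map_π_assoc]

/-- `biproduct.map` of the constant identity family is the identity. [cite: Shimura1998, §7.1 (pp. 46–47), auxiliary step] -/
theorem biproduct_map_const_id :
    (biproduct.map fun _ : Fin m => 𝟙 B) = 𝟙 (⨁ fun _ : Fin m => B) :=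
  biproduct.hom_ext _ _ fun j => by rw [biproduct.map_π, Category.id_comp, Category.comp_id]

/-- The diagonal action `f ↦ ⊕_j f` of `End B` on the power `⨁_{Fin m} B`, a ring homomorphism.
[cite: MumfordAV1970, §19] -/
def diagEnd : End B →+* End (⨁ fun _ : Fin m => B) where
  toFun f := biproduct.map fun _ => f
  map_one' := biproduct_map_const_id B m
  map_mul' f g := by
    rw [End.mul_def, End.mul_def]
    exact biproduct_map_const_comp B m g f
  map_zero' := biproduct_map_const_zero B m
  map_add' f g := biproduct_map_const_add B m f g

/-- Unfolding of `diagEnd`. [cite: MumfordAV1970, §19] -/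
theorem diagEnd_apply (f : End B) : diagEnd B m f = biproduct.map fun _ => f := rfl

variable {B m}

/-- The matrix unit `e_{jk} = π_k ≫ ι_j` of the biproduct `⨁_{Fin m} B` (component `k` to
component `j`). [cite: MumfordAV1970, §19] -/
def unitEnd (j l : Fin m) : End (⨁ fun _ : Fin m => B) :=
  biproduct.π (fun _ : Fin m => B) l ≫ biproduct.ι (fun _ : Fin m => B) j

/-- Multiplication table of the matrix units (`End` multiplies by `f * g = g ≫ f`):
`e_{jl} e_{j'l'} = δ_{l j'} e_{j l'}`. [cite: MumfordAV1970, §19] -/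
theorem unitEnd_mul (j l j' l' : Fin m) :
    (unitEnd j l : End (⨁ fun _ : Fin m => B)) * unitEnd j' l' =
      if j' = l then unitEnd j l' else 0 := by
  rw [End.mul_def, unitEnd, unitEnd, Category.assoc]
  by_cases h : j' = l
  · subst h
    rw [if_pos rfl, biproduct.ι_π_self_assoc, unitEnd]
  · rw [if_neg h, biproduct.ι_π_ne_assoc _ h, zero_comp, comp_zero]
    rfl

/-- The diagonal action commutes with the matrix units. [cite: MumfordAV1970, §19] -/
theorem diagEnd_mul_unitEnd (f : End B) (j l : Fin m) :
    diagEnd B m f * unitEnd j l = unitEnd j l * diagEnd B m f := by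
  rw [End.mul_def, End.mul_def, diagEnd_apply, unitEnd, Category.assoc, biproduct.ι_map,
    biproduct.map_π_assoc]

/-- `Σ_j e_{jj} = 1`. [cite: MumfordAV1970, §19] -/
theorem sum_unitEnd_diag : ∑ j : Fin m, (unitEnd j j : End (⨁ fun _ : Fin m => B)) = 1 := by
  rw [End.one_def, ← biproduct.total]
  rfl

end Blocks

/-! ## §3 Block matrices `Mat_m(R) → End⁰(Bᵐ)` along `φ : R → End⁰(B)` -/

section BlockAct

variable {B : AbelianVariety k} {m : ℕ} {R : Type*} [Ring R] (φ : R →+* B.endAlgebra)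

/-- In `End⁰ = ℚ ⊗_ℤ End`, `q ⊗ f = q · (1 ⊗ f)`. [cite: Shimura1998, §7.1 (pp. 46–47), auxiliary step] -/
theorem tmul_eq_algebraMap_mul_of (X : AbelianVariety k) (q : ℚ) (f : End X) :
    (q ⊗ₜ[ℤ] f : X.endAlgebra) = algebraMap ℚ X.endAlgebra q * endAlgebra.of X f := by
  rw [Algebra.algebraMap_eq_smul_one, smul_mul_assoc, one_mul]
  show q ⊗ₜ[ℤ] f = q • ((1 : ℚ) ⊗ₜ[ℤ] f)
  rw [TensorProduct.smul_tmul', smul_eq_mul, mul_one]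

/-- The scalar `r ∈ R` placed diagonally in `End⁰(Bᵐ)`: `End⁰(diag) (φ r)`. [cite: MumfordAV1970, §19] -/
def diagRat : R →+* (⨁ fun _ : Fin m => B).endAlgebra :=
  (endAlgebra.mapRingHom (diagEnd B m)).toRingHom.comp φ

/-- The rational matrix unit `1 ⊗ e_{jl} ∈ End⁰(Bᵐ)`. [cite: MumfordAV1970, §19] -/
def unitRat (j l : Fin m) : (⨁ fun _ : Fin m => B).endAlgebra :=
  endAlgebra.of _ (unitEnd j l)

/-- Diagonal rational endomorphisms commute with the matrix units. [cite: MumfordAV1970, §19] -/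
theorem mapRingHom_diagEnd_mul_unitRat (x : B.endAlgebra) (j l : Fin m) :
    endAlgebra.mapRingHom (diagEnd B m) x * unitRat j l =
      unitRat j l * endAlgebra.mapRingHom (diagEnd B m) x := by
  induction x using TensorProduct.induction_on with
  | zero =>
    show endAlgebra.mapRingHom (diagEnd B m) (0 : B.endAlgebra) * unitRat j l =
      unitRat j l * endAlgebra.mapRingHom (diagEnd B m) (0 : B.endAlgebra)
    rw [map_zero, zero_mul, mul_zero]
  | tmul q f =>
    rw [endAlgebra.mapRingHom_tmul, tmul_eq_algebraMap_mul_of, unitRat, mul_assoc, ← map_mul,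
      diagEnd_mul_unitEnd, map_mul, ← mul_assoc, ← mul_assoc, Algebra.commutes]
  | add x y hx hy =>
    rw [show endAlgebra.mapRingHom (diagEnd B m) (x + y) =
        endAlgebra.mapRingHom (diagEnd B m) x + endAlgebra.mapRingHom (diagEnd B m) y from map_add _ x y,
      add_mul, mul_add, hx, hy]

/-- Unfolding of `diagRat`. [cite: MumfordAV1970, §19] -/
theorem diagRat_apply (r : R) : diagRat (B := B) (m := m) φ r = endAlgebra.mapRingHom (diagEnd B m) (φ r) :=
  rfl

/-- The diagonal scalars commute with the matrix units. [cite: MumfordAV1970, §19] -/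
theorem unitRat_mul_diagRat (r : R) (j l : Fin m) :
    unitRat j l * diagRat (B := B) φ r = diagRat φ r * unitRat j l := by
  rw [diagRat_apply, mapRingHom_diagEnd_mul_unitRat]

/-- Products of rational matrix units. [cite: MumfordAV1970, §19] -/
theorem unitRat_mul (j l j' l' : Fin m) :
    (unitRat j l : (⨁ fun _ : Fin m => B).endAlgebra) * unitRat j' l' =
      if j' = l then unitRat j l' else 0 := by
  rw [unitRat, unitRat, ← map_mul, unitEnd_mul]
  split_ifs
  · rfl
  · exact map_zero _

/-- **Block matrices act on `Bᵐ`**: `M ↦ Σ_{j,l} φ(M_{jl}) e_{jl}`, a ring homomorphism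
`Mat_m(R) → End⁰(Bᵐ)` (Mumford §19: `End⁰` of a power is the matrix algebra).
[cite: MumfordAV1970, §19] [cite: Shimura1998, §6.2 (proof of Theorem 3)] -/
def blockAct : Matrix (Fin m) (Fin m) R →+* (⨁ fun _ : Fin m => B).endAlgebra where
  toFun M := ∑ j, ∑ l, diagRat φ (M j l) * unitRat j l
  map_one' := by
    have h : ∀ j : Fin m, ∑ l, diagRat (B := B) φ ((1 : Matrix (Fin m) (Fin m) R) j l) * unitRat j l =
        unitRat j j := fun j => by
      rw [Finset.sum_eq_single j]
      · rw [Matrix.one_apply_eq, map_one, one_mul]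
      · intro l _ hl; rw [Matrix.one_apply_ne (Ne.symm hl), map_zero, zero_mul]
      · intro hj; exact absurd (Finset.mem_univ j) hj
    simp_rw [h]
    rw [show (∑ j : Fin m, unitRat j j : (⨁ fun _ : Fin m => B).endAlgebra) =
      endAlgebra.of _ (∑ j : Fin m, unitEnd j j) from (map_sum (endAlgebra.of _) _ _).symm,
      sum_unitEnd_diag, map_one]
  map_mul' M N := by
    have hterm : ∀ j l j' l' : Fin m,
        diagRat (B := B) φ (M j l) * unitRat j l * (diagRat φ (N j' l') * unitRat j' l') =
          if j' = l then diagRat φ (M j l * N j' l') * unitRat j l' else 0 := by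
      intro j l j' l'
      calc diagRat (B := B) φ (M j l) * unitRat j l * (diagRat φ (N j' l') * unitRat j' l')
          = diagRat φ (M j l) * ((unitRat j l * diagRat φ (N j' l')) * unitRat j' l') := by
            simp only [mul_assoc]
        _ = diagRat φ (M j l) * diagRat φ (N j' l') * (unitRat j l * unitRat j' l') := by
            rw [unitRat_mul_diagRat]; simp only [mul_assoc]
        _ = _ := by
            rw [← map_mul, unitRat_mul]
            split_ifs
            · rfl
            · exact mul_zero _
    symm
    calc (∑ j, ∑ l, diagRat (B := B) φ (M j l) * unitRat j l) *
          (∑ j', ∑ l', diagRat φ (N j' l') * unitRat j' l')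
        = ∑ j, ∑ j', (∑ l, diagRat (B := B) φ (M j l) * unitRat j l) *
            (∑ l', diagRat φ (N j' l') * unitRat j' l') := Finset.sum_mul_sum _ _ _ _
      _ = ∑ j, ∑ j', ∑ l, ∑ l', diagRat (B := B) φ (M j l) * unitRat j l *
            (diagRat φ (N j' l') * unitRat j' l') :=
          Finset.sum_congr rfl fun j _ => Finset.sum_congr rfl fun j' _ => Finset.sum_mul_sum _ _ _ _
      _ = ∑ j, ∑ j', ∑ l, ∑ l', if j' = l then diagRat (B := B) φ (M j l * N j' l') * unitRat j l' else 0 :=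
          Finset.sum_congr rfl fun j _ => Finset.sum_congr rfl fun j' _ =>
            Finset.sum_congr rfl fun l _ => Finset.sum_congr rfl fun l' _ => hterm j l j' l'
      _ = ∑ j, ∑ j', ∑ l', ∑ l, if j' = l then diagRat (B := B) φ (M j l * N j' l') * unitRat j l' else 0 :=
          Finset.sum_congr rfl fun j _ => Finset.sum_congr rfl fun j' _ => Finset.sum_comm
      _ = ∑ j, ∑ j', ∑ l', diagRat (B := B) φ (M j j' * N j' l') * unitRat j l' :=
          Finset.sum_congr rfl fun j _ => Finset.sum_congr rfl fun j' _ => Finset.sum_congr rfl fun l' _ =>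
            (Finset.sum_ite_eq Finset.univ j' fun l => diagRat (B := B) φ (M j l * N j' l') * unitRat j l').trans
              (if_pos (Finset.mem_univ _))
      _ = ∑ j, ∑ l', ∑ j', diagRat (B := B) φ (M j j' * N j' l') * unitRat j l' :=
          Finset.sum_congr rfl fun j _ => Finset.sum_comm
      _ = ∑ j, ∑ l', diagRat (B := B) φ ((M * N) j l') * unitRat j l' :=
          Finset.sum_congr rfl fun j _ => Finset.sum_congr rfl fun l' _ => by
            rw [Matrix.mul_apply, map_sum]
            exact (Finset.sum_mul _ _ _).symm
  map_zero' := by simp only [Matrix.zero_apply, map_zero, zero_mul, Finset.sum_const_zero]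
  map_add' M N := by
    simp only [Matrix.add_apply, map_add, add_mul, Finset.sum_add_distrib]

end BlockAct

end Literature.AlgebraicGeometry.ComplexMultiplication.AndreRiemann

end
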